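import Mathlib
import HarnessLib
import Summits.QuantumFields.YangMills.Theses.PencilRigidity
import Literature.MathematicalPhysics.QuantumFieldTheory.OSReconstructionNoE1Proofs
import Summits.QuantumFields.YangMills.Theorems.PencilRigidityCurvatureKernelBoundKernelPinning
import Summits.QuantumFields.YangMills.Theorems.PencilRigidityCurvatureKernelBoundHalfSpaceKernelBumps
import Summits.QuantumFields.YangMills.Theorems.PencilRigidityCurvatureKernelBoundHalfSpaceKernelCluster
import Summits.QuantumFields.YangMills.Theorems.PencilRigidityCurvatureKernelBoundHalfSpaceKernelRiemann
import Summits.QuantumFields.YangMills.Theorems.PencilRigidityCurvatureKernelBoundHalfSpaceKernelIdentification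

/-!
# `CurvatureKernelBound` — stub H `HalfSpaceKernel`: tensor representation near a separated configuration

(support for stmt-QuantumFields-11687, line `sixteen-charts-analytic-kernel`, skeleton v11)

`two_point_tensor_eq_integral`: `S₂(f ⊗ g) = ∫ K(x₀−x₁) f g` for complex tensors supported near `(z₀,z₁)`.
Headline (registered sub-goal): `TimeCoordinateOnBall`.
-/

noncomputable section

open scoped BigOperators Topology SchwartzMap ComplexConjugate InnerProductSpace
open MeasureTheory Filter Set Metric
open Literature.MathematicalPhysics.QuantumLattice Literature.MathematicalPhysics.AQFT
open Literature.MathematicalPhysics.QuantumFieldTheory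
open Literature.MathematicalPhysics.QuantumLattice.SchwingerFamily (timeVec)

namespace Summit.QuantumFields.YangMills.Theorems.CurvatureKernel

section Identification

variable (ϖ : (EuclideanSpace ℝ (Fin 4)) → ℝ) (hϖc : Continuous ϖ) (hϖ0 : ∀ x, 0 ≤ ϖ x) (hϖ1 : ∀ x, ϖ x ≤ 1)
  (hϖsupp : tsupport ϖ ⊆ Metric.closedBall (0 : (EuclideanSpace ℝ (Fin 4))) 2)
  (hϖle : ∀ (N : ℕ) (y : (EuclideanSpace ℝ (Fin 4))), ∑ j ∈ Fintype.piFinset (fun _ : Fin 4 => Finset.Icc (-(N : ℤ)) N),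
    ϖ (y - WithLp.toLp 2 (fun i => ((j i : ℤ) : ℝ))) ≤ 1)
  (hϖeq : ∀ (N : ℕ) (y : (EuclideanSpace ℝ (Fin 4))), (∀ i : Fin 4, |y i| ≤ N) →
    ∑ j ∈ Fintype.piFinset (fun _ : Fin 4 => Finset.Icc (-(N : ℤ)) N), ϖ (y - WithLp.toLp 2 (fun i => ((j i : ℤ) : ℝ))) = 1)
  (hI : 0 < ∫ x, ϖ x)
  (b : ℕ → (EuclideanSpace ℝ (Fin 4)) → 𝓢(EuclideanSpace ℝ (Fin 4), ℝ))
  (hb : ∀ (n : ℕ) (c x : EuclideanSpace ℝ (Fin 4)), b n c x = ϖ ((((n : ℝ) + 2)) • (x - c)))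
  {S : SchwingerFamily (EuclideanSpace ℝ (Fin 4))} (h : OSReconstructionNoE1 S.toLabelled)
  (htr : (∀ (n : ℕ) (a : (EuclideanSpace ℝ (Fin 4))) (F : SchwartzMap (Fin n → (EuclideanSpace ℝ (Fin 4))) ℂ), IsOffDiagonal F → S n (translateMulti a F) = S n F))
  (𝒰 : Ultrafilter ℕ) (h𝒰 : (↑𝒰 : Filter ℕ) ≤ atTop)

include hϖc hϖ0 hϖle hϖeq hI htr h𝒰 in
/-- **Tensor representation near a separated configuration** (stub H, output form): with `K` agreeing with
`ξ ↦ ⟪Ψ, e^{-(−ξ⁰−2p)H} U(−ξ⃗) Ψ⟫` on `{ξ⁰ ≤ −2p}`, for complex `f, g` supported in `R`-balls about `z₀, z₁`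
(`p + 2R ≤ −z₀⁰`, `p + 2R ≤ z₁⁰`): `S₂(f ⊗ g) = ∫ K(x₀−x₁) f(x₀) g(x₁)`, with integrable integrand. From the
identification applied to the real and imaginary parts of `g` and of `conj∘f∘θ`, `⟪Ψ_{conj f θ}, Ψ_g⟫ = S₂(f⊗g)`,
Fubini and the `θ`-invariance of Lebesgue measure. [folklore] -/
theorem two_point_tensor_eq_integral
    (p r₀ A B : ℝ) (hA : 0 ≤ A) (hB : 0 ≤ B)
    (hLB : (∀ (r : ℝ), 0 < r → r ≤ r₀ → ∀ (f : Fin 2 → SchwartzMap (EuclideanSpace ℝ (Fin 4)) ℝ) (F : SchwartzMap (Fin 2 → (EuclideanSpace ℝ (Fin 4))) ℂ) (M₀ M₁ : ℝ), IsTensorOf F (fun i => ofRealTest (f i)) → tsupport ((f 0 : SchwartzMap (EuclideanSpace ℝ (Fin 4)) ℝ) : (EuclideanSpace ℝ (Fin 4)) → ℝ) ⊆ Metric.closedBall (EuclideanSpace.single (0 : Fin 4) (-p)) r → tsupport ((f 1 : SchwartzMap (EuclideanSpace ℝ (Fin 4)) ℝ) : (EuclideanSpace ℝ (Fin 4)) →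 ℝ) ⊆ Metric.closedBall (EuclideanSpace.single (0 : Fin 4) p) r → (∀ x, |f 0 x| ≤ M₀) → (∀ x, |f 1 x| ≤ M₁) → ‖S 2 F‖ ≤ A * (∫ x : (EuclideanSpace ℝ (Fin 4)), |f 0 x|) * (∫ x : (EuclideanSpace ℝ (Fin 4)), |f 1 x|) + B * r ^ 8 * M₀ * M₁))
    (w : ℕ → h.Hilbert)
    (hw : ∀ (n : ℕ) (hn : 2 * ((n : ℝ) + 2)⁻¹ < (EuclideanSpace.single (0 : Fin 4) p : EuclideanSpace ℝ (Fin 4)) 0),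
      w n = ((((((n : ℝ) + 2)⁻¹) ^ 4 * ∫ x, ϖ x)⁻¹ : ℝ) : ℂ) •
        h.fieldVec 1 (fun _ => ()) _ (isTimeOrdered_tensorFin_one (tsupport_ofRealTest_bump_pos ϖ hϖsupp b hb n hn)))
    (Cw : ℝ) (hCw : ∀ n, ‖w n‖ ≤ Cw)
    (Ψ : h.Hilbert) (hΨ : ∀ Φ : h.Hilbert, Tendsto (fun n => ⟪Φ, w n⟫_ℂ) (↑𝒰 : Filter ℕ) (𝓝 ⟪Φ, Ψ⟫_ℂ))
    (K : (EuclideanSpace ℝ (Fin 4)) → ℂ)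
    (hK : ∀ ξ : EuclideanSpace ℝ (Fin 4), ξ 0 ≤ -(2 * p) → K ξ = ⟪Ψ, h.transfer (-(ξ 0) - 2 * p) (h.translate (-ξ) Ψ)⟫_ℂ)
    (z : Fin 2 → EuclideanSpace ℝ (Fin 4)) (R : ℝ) (hR : 0 < R) (hRr : 4 * R ≤ r₀) (hRp : 4 * R ≤ p)
    (hz0 : p + 2 * R ≤ -(z 0 0)) (hz1 : p + 2 * R ≤ z 1 0)
    (f g : 𝓢(EuclideanSpace ℝ (Fin 4), ℂ)) (hf : tsupport (f : EuclideanSpace ℝ (Fin 4) → ℂ) ⊆ Metric.ball (z 0) R)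
    (hg : tsupport (g : EuclideanSpace ℝ (Fin 4) → ℂ) ⊆ Metric.ball (z 1) R)
    (F : 𝓢((Fin 2 → EuclideanSpace ℝ (Fin 4)), ℂ)) (hF : IsTensorOf F ![f, g]) :
    MeasureTheory.Integrable (fun x : Fin 2 → EuclideanSpace ℝ (Fin 4) => K (x 0 - x 1) * F x) ∧
      S 2 F = ∫ x : Fin 2 → EuclideanSpace ℝ (Fin 4), K (x 0 - x 1) * F x := by
  -- ### the continuous kernel formula and its agreement with `K` on the relevant differences
  set Kf : EuclideanSpace ℝ (Fin 4) → ℂ := fun ξ => ⟪Ψ, h.transfer (-(ξ 0) - 2 * p) (h.translate (-ξ) Ψ)⟫_ℂ with hKf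
  have hKf_cont : Continuous Kf := by
    have hc : Continuous fun ξ : EuclideanSpace ℝ (Fin 4) => h.translate (-ξ) (h.transfer (-(ξ 0) - 2 * p) Ψ) :=
      continuous_translate_transfer_comp h Ψ
        (((EuclideanSpace.proj (0 : Fin 4)).continuous.neg).sub continuous_const) continuous_neg
    simp_rw [hKf, ← h.translate_transfer]
    exact continuous_const.inner hc
  have hKf_bd : ∀ ξ, ‖Kf ξ‖ ≤ ‖Ψ‖ ^ 2 := fun ξ => norm_inner_transfer_translate_le h Ψ _ _
  -- time coordinates on the two balls
  have hball0 : ∀ x ∈ Metric.ball (z 0) R, x 0 < -(p + R) := by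
    intro x hx
    rw [Metric.mem_ball, dist_eq_norm] at hx
    have h1 : |(x - z 0) 0| ≤ ‖x - z 0‖ := by simpa using PiLp.norm_apply_le (p := 2) (x - z 0) 0
    rw [PiLp.sub_apply, abs_le] at h1
    linarith [h1.2]
  have hball1 : ∀ x ∈ Metric.ball (z 1) R, p + R < x 0 := by
    intro x hx
    rw [Metric.mem_ball, dist_eq_norm] at hx
    have h1 : |(x - z 1) 0| ≤ ‖x - z 1‖ := by simpa using PiLp.norm_apply_le (p := 2) (x - z 1) 0
    rw [PiLp.sub_apply, abs_le] at h1
    linarith [h1.1]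
  have hf0 : ∀ x, f x ≠ 0 → x 0 < -(p + R) := fun x hx => hball0 x (hf (subset_tsupport _ (Function.mem_support.2 hx)))
  have hg0 : ∀ x, g x ≠ 0 → p + R < x 0 := fun x hx => hball1 x (hg (subset_tsupport _ (Function.mem_support.2 hx)))
  have hKK : ∀ x₀ x₁ : EuclideanSpace ℝ (Fin 4), f x₀ ≠ 0 → g x₁ ≠ 0 → K (x₀ - x₁) = Kf (x₀ - x₁) := by
    intro x₀ x₁ h0 h1
    rw [hK _ (by rw [PiLp.sub_apply]; linarith [hf0 x₀ h0, hg0 x₁ h1])]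
  -- the tensor and the pointwise replacement of `K` by `Kf`
  have hFeq : ∀ x : Fin 2 → EuclideanSpace ℝ (Fin 4), F x = f (x 0) * g (x 1) := fun x => by
    rw [hF x, Fin.prod_univ_two]; rfl
  have hptw : ∀ x : Fin 2 → EuclideanSpace ℝ (Fin 4), K (x 0 - x 1) * F x = Kf (x 0 - x 1) * F x := by
    intro x
    rw [hFeq]
    by_cases h0 : f (x 0) = 0
    · simp [h0]
    by_cases h1 : g (x 1) = 0
    · simp [h1]
    rw [hKK _ _ h0 h1]
  have hint : MeasureTheory.Integrable (fun x : Fin 2 → EuclideanSpace ℝ (Fin 4) => Kf (x 0 - x 1) * F x) := by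
    haveI : (volume : Measure (Fin 2 → EuclideanSpace ℝ (Fin 4))).HasTemperateGrowth :=
      Measure.IsAddHaarMeasure.instHasTemperateGrowth
    exact F.integrable.bdd_mul (hKf_cont.comp ((continuous_apply 0).sub (continuous_apply 1))).aestronglyMeasurable
      (ae_of_all _ fun x => hKf_bd _)
  refine ⟨hint.congr (ae_of_all _ fun x => (hptw x).symm), ?_⟩
  rw [integral_congr_ae (ae_of_all _ hptw)]
  -- ### the OS side: `S 2 F = ⟪Ψ_β, Ψ_g⟫` with `β = conj ∘ f ∘ θ`
  set β : 𝓢(EuclideanSpace ℝ (Fin 4), ℂ) := starTest (thetaTest 4 f) with hβ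
  have hfneg : tsupport (f : EuclideanSpace ℝ (Fin 4) → ℂ) ⊆ {y | y 0 < 0} := fun x hx => by
    have := hball0 x (hf hx); show x 0 < 0; linarith
  have hβpos : tsupport (β : EuclideanSpace ℝ (Fin 4) → ℂ) ⊆ {y | 0 < y 0} := tsupport_starTest_thetaTest_subset_pos hfneg
  have hgpos : tsupport (g : EuclideanSpace ℝ (Fin 4) → ℂ) ⊆ {y | 0 < y 0} := fun x hx => by
    have := hball1 x (hg hx); show 0 < x 0; linarith
  -- supports of `β` and `g` in the closed balls about `θ z₀` and `z₁`
  have hβsupp : tsupport (β : EuclideanSpace ℝ (Fin 4) → ℂ) ⊆ Metric.closedBall (timeReflection 4 (z 0)) R := by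
    intro y hy
    have hy' := hf (timeReflection_mem_tsupport_of_mem_tsupport_starTest_thetaTest f hy)
    rw [Metric.mem_ball] at hy'
    have e : dist (timeReflection 4 y) (z 0) = dist y (timeReflection 4 (z 0)) := by
      conv_lhs => rw [← timeReflection_timeReflection (d := 4) (z 0)]
      rw [LinearIsometryEquiv.dist_map]
    rw [Metric.mem_closedBall, ← e]
    exact hy'.le
  have hgsupp : tsupport (g : EuclideanSpace ℝ (Fin 4) → ℂ) ⊆ Metric.closedBall (z 1) R := hg.trans Metric.ball_subset_closedBall
  have hqβ : p + 2 * R ≤ (timeReflection 4 (z 0)) 0 := by rw [timeReflection_apply]; simp only [↓reduceIte]; linarith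
  have hS : S 2 F = ⟪h.fieldVec 1 (fun _ => ()) _ (isTimeOrdered_tensorFin_one hβpos),
      h.fieldVec 1 (fun _ => ()) _ (isTimeOrdered_tensorFin_one hgpos)⟫_ℂ := by
    rw [h.inner_fieldVec_fieldVec (fun _ => ()) (fun _ => ()) _ _ (isAppendTensorOf_conjTheta β g)]
    have hFt : F = SchwartzMap.tensorFin 2 ![starTest (thetaTest 4 β), g] := by
      rw [hβ, starTest_thetaTest_starTest_thetaTest]
      ext x; rw [hFeq, tensorFin_two_eval]
    rw [hFt]; rfl
  rw [hS]
  -- ### the identification, twice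
  have hVg := inner_fieldVec_eq_integral_complex ϖ hϖc hϖ0 hϖsupp hϖle hϖeq hI b hb h htr 𝒰 h𝒰 p r₀ A B hA hB hLB w hw Cw hCw Ψ hΨ
    g (z 1) R hR hgsupp hRr hRp hz1 hgpos (h.fieldVec 1 (fun _ => ()) _ (isTimeOrdered_tensorFin_one hβpos))
  have hVβ := fun X : h.Hilbert => inner_fieldVec_eq_integral_complex ϖ hϖc hϖ0 hϖsupp hϖle hϖeq hI b hb h htr 𝒰 h𝒰 p r₀ A B hA hB
    hLB w hw Cw hCw Ψ hΨ β (timeReflection 4 (z 0)) R hR hβsupp hRr hRp hqβ hβpos X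
  rw [hVg]
  -- ### the matrix elements `⟪T c' Ψ, T c Ψ⟫` are kernel values
  have hTT : ∀ c c' : EuclideanSpace ℝ (Fin 4), p ≤ c 0 → p ≤ c' 0 →
      ⟪h.transfer (c' 0 - p) (h.translate c' Ψ), h.transfer (c 0 - p) (h.translate c Ψ)⟫_ℂ = Kf (timeReflection 4 c' - c) := by
    intro c c' hc hc'
    have h1 : ⟪h.transfer (c' 0 - p) (h.translate c' Ψ), h.transfer (c 0 - p) (h.translate c Ψ)⟫_ℂ =
        ⟪Ψ, h.transfer ((c' 0 - p) + (c 0 - p)) (h.translate (c - c') Ψ)⟫_ℂ := by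
      rw [h.inner_transfer_left, ← ContinuousLinearMap.comp_apply, ← h.transfer_add (by linarith) (by linarith)]
      have e1 : h.translate (-c') (h.translate c' Ψ) = Ψ := by
        rw [← h.translate_add_apply, neg_add_cancel, h.translate_zero_apply]
      conv_lhs => rw [← LinearIsometryEquiv.inner_map_map (h.translate (-c')), e1, h.translate_transfer,
        ← h.translate_add_apply, show -c' + c = c - c' by abel]
    rw [h1]
    show _ = ⟪Ψ, h.transfer (-((timeReflection 4 c' - c) 0) - 2 * p) (h.translate (-(timeReflection 4 c' - c)) Ψ)⟫_ℂ
    have ht : -((timeReflection 4 c' - c) 0) - 2 * p = (c' 0 - p) + (c 0 - p) := by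
      rw [PiLp.sub_apply, timeReflection_apply]; simp only [↓reduceIte]; ring
    have hs : h.translate (-(timeReflection 4 c' - c)) Ψ = h.translate (c - c') Ψ := by
      have hsp : spatialPart 0 (-(timeReflection 4 c' - c)) = spatialPart 0 (c - c') := by
        ext i; by_cases hi : i = 0 <;> simp [hi]
      rw [← h.translate_spatialPart, hsp, h.translate_spatialPart]
    rw [ht, hs]
  -- ### the inner matrix element `⟪Ψ_β, T c Ψ⟫` as an integral against `f ∘ θ`, then against `f`
  have hmp : MeasurePreserving (timeReflection 4 : EuclideanSpace ℝ (Fin 4) → EuclideanSpace ℝ (Fin 4)) volume volume :=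
    (timeReflection 4).measurePreserving
  have hinner : ∀ c : EuclideanSpace ℝ (Fin 4), g c ≠ 0 →
      ⟪h.fieldVec 1 (fun _ => ()) _ (isTimeOrdered_tensorFin_one hβpos), h.transfer (c 0 - p) (h.translate c Ψ)⟫_ℂ =
        ∫ x₀ : EuclideanSpace ℝ (Fin 4), f x₀ * Kf (x₀ - c) := by
    intro c hc
    have hcp : p ≤ c 0 := by linarith [hg0 c hc]
    rw [← inner_conj_symm, hVβ, ← integral_conj]
    have e : (fun c' : EuclideanSpace ℝ (Fin 4) => (starRingEnd ℂ) (β c' * ⟪h.transfer (c 0 - p) (h.translate c Ψ),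
        h.transfer (c' 0 - p) (h.translate c' Ψ)⟫_ℂ)) = fun c' => f (timeReflection 4 c') * Kf (timeReflection 4 c' - c) := by
      funext c'
      rw [map_mul, inner_conj_symm, hβ, starTest_thetaTest_apply, Complex.conj_conj]
      by_cases hfc : f (timeReflection 4 c') = 0
      · rw [hfc, zero_mul, zero_mul]
      · have hc' : p ≤ c' 0 := by
          have := hf0 _ hfc
          rw [timeReflection_apply] at this; simp only [↓reduceIte] at this; linarith
        rw [hTT c c' hcp hc']
    rw [e]
    exact hmp.integral_comp' (f := (timeReflection 4).toMeasurableEquiv)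
      (fun x₀ : EuclideanSpace ℝ (Fin 4) => f x₀ * Kf (x₀ - c))
  have hLHS : (∫ c, g c * ⟪h.fieldVec 1 (fun _ => ()) _ (isTimeOrdered_tensorFin_one hβpos), h.transfer (c 0 - p) (h.translate c Ψ)⟫_ℂ) =
      ∫ c, g c * ∫ x₀ : EuclideanSpace ℝ (Fin 4), f x₀ * Kf (x₀ - c) := by
    refine integral_congr_ae (Eventually.of_forall fun c => ?_)
    by_cases hc : g c = 0
    · simp only [hc, zero_mul]
    · show g c * _ = g c * _
      rw [hinner c hc]
  rw [hLHS]
  -- ### Fubini on `(Fin 2 → ℝ⁴) ≃ ℝ⁴ × ℝ⁴`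
  have hprod : Integrable (fun zz : EuclideanSpace ℝ (Fin 4) × EuclideanSpace ℝ (Fin 4) => Kf (zz.1 - zz.2) * (f zz.1 * g zz.2))
      ((volume : Measure (EuclideanSpace ℝ (Fin 4))).prod volume) := by
    have h1 : Integrable (fun zz : EuclideanSpace ℝ (Fin 4) × EuclideanSpace ℝ (Fin 4) => f zz.1 * g zz.2)
        ((volume : Measure (EuclideanSpace ℝ (Fin 4))).prod volume) := f.integrable.mul_prod g.integrable
    exact h1.bdd_mul (hKf_cont.comp (continuous_fst.sub continuous_snd)).aestronglyMeasurable (ae_of_all _ fun zz => hKf_bd _)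
  have hFin : (∫ x : Fin 2 → EuclideanSpace ℝ (Fin 4), Kf (x 0 - x 1) * F x) =
      ∫ zz : EuclideanSpace ℝ (Fin 4) × EuclideanSpace ℝ (Fin 4), Kf (zz.1 - zz.2) * (f zz.1 * g zz.2) := by
    rw [← (volume_preserving_finTwoArrow (EuclideanSpace ℝ (Fin 4))).integral_comp']
    refine integral_congr_ae (Eventually.of_forall fun x => ?_)
    show Kf (x 0 - x 1) * F x = Kf (x 0 - x 1) * (f (x 0) * g (x 1))
    rw [hFeq]
  rw [hFin, show (volume : Measure (EuclideanSpace ℝ (Fin 4) × EuclideanSpace ℝ (Fin 4))) =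
      (volume : Measure (EuclideanSpace ℝ (Fin 4))).prod volume from rfl, integral_prod_symm _ hprod]
  refine integral_congr_ae (Eventually.of_forall fun c => ?_)
  show g c * ∫ x₀, f x₀ * Kf (x₀ - c) = ∫ x₀, Kf (x₀ - c) * (f x₀ * g c)
  rw [← integral_const_mul]
  refine integral_congr_ae (Eventually.of_forall fun x₀ => ?_)
  show g c * (f x₀ * Kf (x₀ - c)) = Kf (x₀ - c) * (f x₀ * g c)
  ring

end Identification

/-- **Sub-goal `TimeCoordinateOnBall`** (helper-file headline for stub `HalfSpaceKernel`; registered signature): the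
time coordinate varies by less than the radius on a ball. [folklore] -/
theorem TimeCoordinateOnBall : ∀ (z x : EuclideanSpace ℝ (Fin 4)) (R : ℝ), x ∈ Metric.ball z R → |x 0 - z 0| < R := by
  intro z x R hx
  rw [Metric.mem_ball, dist_eq_norm] at hx
  have h1 : |(x - z) 0| ≤ ‖x - z‖ := by simpa using PiLp.norm_apply_le (p := 2) (x - z) 0
  rw [PiLp.sub_apply] at h1
  exact lt_of_le_of_lt h1 hx

end Summit.QuantumFields.YangMills.Theorems.CurvatureKernel

end
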